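import Summits.NavierStokesRegularity.FunctionalMining.BiaxialEikonalSpectrum
import Summits.NavierStokesRegularity.FunctionalMining.BiaxialEikonalDirection
import HarnessLib

/-!
# FunctionalMining — eigenvalue form of the eikonal obstruction along an ARBITRARY direction: a field
# (or a strain) invariant along any `K ≠ 0` has a degenerate strain somewhere; on `T³`, a point with `λ₂ = 0`

Search for candidate a priori estimates; no regularity claim. Cell `pub-nsfunc`, prove seat (gen 20).
Static calculus of smooth fields on the flat torus; nothing about Navier–Stokes dynamics. Joins
`BiaxialEikonalSpectrum` (coordinate direction `eₖ`) with `BiaxialEikonalDirection` (arbitrary `K`).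

* `midEig_eq_zero_of_torusStrainEig_eq_zero` (pointwise, `card d = 3`, divergence free): a zero sorted
  eigenvalue at `p` forces `λ₂(p) = 0` and `λ₃(p) = −λ₁(p)` (the tool behind both versions).
* `exists_det_strain_eq_zero_dir`, `exists_torusStrainEig_eq_zero_dir`: if `∂_K v ≡ 0` with `K ≠ 0`
  (in particular if `S(v)` is invariant under `x ↦ x + proj(tK)`, by strain translation rigidity), the
  strain is singular somewhere (`S(v)(p)K = 0` at a maximum of `K·v`, `exists_strain_mulVec_eq_zero_dir`).
* **`exists_midEig_eq_zero_dir`** / `_of_strain_invariant_dir` (`card d = 3`, div-free): a point with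
  `λ₂ = 0`, `λ₃ = −λ₁`; hence `not_forall_topBiaxial_dir`: **no smooth divergence-free field on `T³`
  invariant along any direction `K ≠ 0` (rational or irrational) is top-biaxial `λ₁ = λ₂ > 0` at every
  point** (variable modulus), and `exists_gap_point_dir` (a point inside every top-gap class).
[ours]
-/

noncomputable section

open MeasureTheory Set Filter Topology

namespace Summit.NavierStokesRegularity.FunctionalMining
open Literature.Analysis Literature.Analysis.FunctionSpaces Literature.Analysis.FunctionSpaces.Torus
  Literature.Analysis.FluidPDE

namespace BiaxialEikonal

variable {d : Type*} [Fintype d] [DecidableEq d]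

/-- **Pointwise tool (`card d = 3`, divergence free): a zero sorted strain eigenvalue at `p` forces
`λ₂(p) = 0` and `λ₃(p) = −λ₁(p)`** (the sorted zero-sum triple containing `0` has middle entry `0`).
[ours] -/
theorem midEig_eq_zero_of_torusStrainEig_eq_zero (hd : Fintype.card d = 3)
    {v : UnitAddTorus d → EuclideanSpace ℝ d} (hv : Torus.IsSmooth v) (hdiv : Torus.IsDivFree v)
    {p : UnitAddTorus d} {i : Fin (Fintype.card d)} (hi : torusStrainEig v p i = 0) :
    torusStrainMidEig v p = 0 ∧ torusStrainBotEig v p = -torusStrainTopEig v p := by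
  set e := torusStrainEig v p with he
  set f : Fin 3 → ℝ := fun j => e (Fin.cast hd.symm j) with hfdef
  have hf : Antitone f := fun a b hab =>
    torusStrainEig_antitone v p (show Fin.cast hd.symm a ≤ Fin.cast hd.symm b by simpa using hab)
  have hsume : ∑ j, f j = ∑ k', e k' :=
    Fintype.sum_equiv (finCongr hd.symm) f e (fun j => rfl)
  have hsum3 : f 0 + f 1 + f 2 = 0 := by
    rw [← Fin.sum_univ_three, hsume, he, sum_torusStrainEig_eq_zero hv hdiv p]
  have hfi : f (Fin.cast hd i) = 0 := by
    have hc : Fin.cast hd.symm (Fin.cast hd i) = i := Fin.ext rfl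
    simp only [hfdef, hc]
    exact hi
  have hmid : f 1 = 0 := sorted_three_middle_eq_zero hf hsum3 hfi
  have htop : torusStrainTopEig v p = f 0 := by
    unfold torusStrainTopEig
    rw [← he, ← (finCongr hd.symm).iSup_comp]
    change (⨆ j, f j) = f 0
    exact TopEig.iSup_eq_apply_zero_of_antitone (by norm_num) hf
  have hbot : torusStrainBotEig v p = f 2 := by
    unfold torusStrainBotEig
    rw [← he, ← (finCongr hd.symm).iInf_comp]
    change (⨅ j, f j) = f 2
    exact le_antisymm (ciInf_le (Set.finite_range f).bddBelow 2) (le_ciInf fun j => hf (Fin.le_last j))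
  refine ⟨?_, ?_⟩
  · unfold torusStrainMidEig
    rw [← he, sum_torusStrainEig_eq_zero hv hdiv p, htop, hbot]
    linarith
  · rw [htop, hbot]
    linarith

section Dir

variable {v : UnitAddTorus d → EuclideanSpace ℝ d} (hv : Torus.IsSmooth v) {K : EuclideanSpace ℝ d}
  (hK0 : K ≠ 0)
include hv hK0

/-- If `∂_K v ≡ 0` for some `K ≠ 0`, the strain is singular somewhere. [ours] -/
theorem exists_det_strain_eq_zero_dir (hK : ∀ x, ∑ l, K l • Torus.partialDeriv l v x = 0) :
    ∃ p, (torusStrainMatrix v p).det = 0 := by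
  obtain ⟨p, hp⟩ := exists_strain_mulVec_eq_zero_dir hv K hK
  refine ⟨p, Matrix.exists_mulVec_eq_zero_iff.mp ⟨fun j => K j, ?_, ?_⟩⟩
  · intro h0; apply hK0; ext j; exact congrFun h0 j
  · funext i
    exact hp i

/-- … hence some sorted strain eigenvalue vanishes somewhere. [ours] -/
theorem exists_torusStrainEig_eq_zero_dir (hK : ∀ x, ∑ l, K l • Torus.partialDeriv l v x = 0) :
    ∃ p, ∃ i, torusStrainEig v p i = 0 := by
  obtain ⟨p, hdet⟩ := exists_det_strain_eq_zero_dir hv hK0 hK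
  rw [det_torusStrainMatrix_eq_prod] at hdet
  obtain ⟨i, -, hi⟩ := Finset.prod_eq_zero_iff.mp hdet
  exact ⟨p, i, hi⟩

/-- **`card d = 3`, divergence free, `∂_K v ≡ 0` with `K ≠ 0`: a point with `λ₂ = 0`, `λ₃ = −λ₁`.** [ours] -/
theorem exists_midEig_eq_zero_dir (hd : Fintype.card d = 3) (hdiv : Torus.IsDivFree v)
    (hK : ∀ x, ∑ l, K l • Torus.partialDeriv l v x = 0) :
    ∃ p, torusStrainMidEig v p = 0 ∧ torusStrainBotEig v p = -torusStrainTopEig v p := by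
  obtain ⟨p, i, hi⟩ := exists_torusStrainEig_eq_zero_dir hv hK0 hK
  exact ⟨p, midEig_eq_zero_of_torusStrainEig_eq_zero hd hv hdiv hi⟩

/-- The same when only the STRAIN is invariant along `K` (strain translation rigidity
`dirDeriv_eq_zero_of_strain_invariant_dir`). [ours] -/
theorem exists_midEig_eq_zero_of_strain_invariant_dir (hd : Fintype.card d = 3) (hdiv : Torus.IsDivFree v)
    (hS : ∀ (x : UnitAddTorus d) (t : ℝ), torusStrainMatrix v (x + proj (t • K)) = torusStrainMatrix v x) :
    ∃ p, torusStrainMidEig v p = 0 ∧ torusStrainBotEig v p = -torusStrainTopEig v p :=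
  exists_midEig_eq_zero_dir hv hK0 hd hdiv (dirDeriv_eq_zero_of_strain_invariant_dir hv K hS)

/-- **No smooth divergence-free field on `T³` whose strain is invariant along some direction `K ≠ 0` is
top-biaxial (`λ₁ = λ₂ > 0`) at every point** — variable modulus, any real direction. [ours] -/
theorem not_forall_topBiaxial_dir (hd : Fintype.card d = 3) (hdiv : Torus.IsDivFree v)
    (hS : ∀ (x : UnitAddTorus d) (t : ℝ), torusStrainMatrix v (x + proj (t • K)) = torusStrainMatrix v x) :
    ¬ ∀ x, torusStrainMidEig v x = torusStrainTopEig v x ∧ 0 < torusStrainTopEig v x := by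
  intro h
  obtain ⟨p, hmid, -⟩ := exists_midEig_eq_zero_of_strain_invariant_dir hv hK0 hd hdiv hS
  have := h p
  linarith [this.1, this.2]

/-- … nor bottom-biaxial (`λ₂ = λ₃ < 0`) at every point. [ours] -/
theorem not_forall_botBiaxial_dir (hd : Fintype.card d = 3) (hdiv : Torus.IsDivFree v)
    (hS : ∀ (x : UnitAddTorus d) (t : ℝ), torusStrainMatrix v (x + proj (t • K)) = torusStrainMatrix v x) :
    ¬ ∀ x, torusStrainMidEig v x = torusStrainBotEig v x ∧ torusStrainBotEig v x < 0 := by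
  intro h
  obtain ⟨p, hmid, -⟩ := exists_midEig_eq_zero_of_strain_invariant_dir hv hK0 hd hdiv hS
  have := h p
  linarith [this.1, this.2]

/-- Such a field has a point inside every top-gap class `λ₂ ≤ (1 − η)λ₁`, `η ≤ 1`. [ours] -/
theorem exists_gap_point_dir (hd : Fintype.card d = 3) (hdiv : Torus.IsDivFree v)
    (hS : ∀ (x : UnitAddTorus d) (t : ℝ), torusStrainMatrix v (x + proj (t • K)) = torusStrainMatrix v x) :
    ∃ p, ∀ η : ℝ, η ≤ 1 → torusStrainMidEig v p ≤ (1 - η) * torusStrainTopEig v p := by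
  obtain ⟨p, hmid, -⟩ := exists_midEig_eq_zero_of_strain_invariant_dir hv hK0 hd hdiv hS
  refine ⟨p, fun η hη => ?_⟩
  rw [hmid]
  exact mul_nonneg (by linarith) (torusStrainTopEig_nonneg hd hv hdiv p)

end Dir

end BiaxialEikonal

end Summit.NavierStokesRegularity.FunctionalMining

end
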